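import Mathlib
import HarnessLib
import Summits.HubbardSuperconductivity.HubbardSuperconductivity.Theorems.KLProgrammeKLRegimeEnginePairTransferRelResAnalyticResolved

/-!
# Route `KLProgramme` — ENGINE child gen 8 (stmt-HubbardSuperconductivity-20437 `KLRegimeEngineV17F2`), skeleton v2 class #5 rev 3, Ẽ-organisation STEP:
# the RESOLVED relative source SPLIT — `pairTransferRelResIdx_family_succ_of_analytic_resolved_split`
# (cell gate-hubbard-kl, seat hubbard-kl-k3c1-p1 g15, technique «composed-map remainder propagation»; row 60 of CLASS5-RESOLVED-STEP.md, evidence #55 on 20437)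

WHY.  Row 29 (`pairTransferRelResIdx_family_succ_of_analytic_split`, p605954) split the relative source `X_rel = S_j·(1 + diag a·A_{j′}) + A_j·diag a·S_{j′} − S_{j′}` into SUPS:
`ξ′ = ξΔ + mA(ξ₁+ξ₂)·1028·klIdxMass n j′` — the entry priced by the located «(X).3-PH-CUBIC-SLOT».  Over the resolved door (row 59, `…_of_analytic_resolved`) the source
enters only through its resolved slice integral `I(x,y) ≥ ∫₀¹‖X_rel(t)(x,y)‖dt`, and `kltc_relSource_resolved_le` (p635683) splits it RESOLVED:
`‖X_rel(x,y)‖ ≤ ‖(S_j − S_{j′})(x,y)‖ + mA·Σ_c‖S_j(x,c)‖·|a(c)| + mA·Σ_c|a(c)|·‖S_{j′}(c,y)‖`.  THIS FILE keys row 59 on the split rows: per pair / class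
`IΔ(x,y) ≥ ∫₀¹‖(S_j − S_{j′})(t)(x,y)‖dt` (the member DIFFERENCE — every term carries the `D`-line; k3c2-p2's `D`-rows), `J₁(x,c) ≥ ∫₀¹‖S_j(t)(x,c)‖dt` and
`J₂(c,y) ≥ ∫₀¹‖S_{j′}(t)(c,y)‖dt` (each member's Riccati defect RESOLVED IN THE LOOP LEG `c`), a `t`-uniform profile `α(c) ≥ |a(t)(c)|` of the running relative weight
(the `D`-transfer weight: `|tₙ^{K_{n+1}}[D](c)| + ∫|ȧ(c)|`, windowed masses = the «(ᾱ)-WINDOW» row), and `Ran ≥ R₀ + IΔ + mA·Σ_c J₁(x,c)α(c) + mA·Σ_c α(c)J₂(c,y)`.  So the member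
particle–hole classes of `J₁, J₂` reach the ROOM only CONVOLVED against `α` — the angular-mass slot of CLASS5-RESOLVED-STEP §3 — and everything else is row 59 verbatim.
Plumbing (continuity of the integrands from the member flow data, `intervalIntegral.integral_mono_on`); the analytic SIZES stay hypotheses; nothing asserts (X).3, (c), K3
or superconductivity.  0 kit · 0 lit.
-/

noncomputable section

namespace Summit.HubbardSuperconductivity.HubbardSuperconductivity.Theorems.KLRegimeSplit

set_option linter.dupNamespace false -- summit = problem name (single-conjunct summit), D-0017

open Finset Matrix Set Literature.MathematicalPhysics.QuantumLattice Literature.Probability.LatticeModels GrassmannAlgebra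
open Literature.MathematicalPhysics.QuantumLattice.FermiRG
open Summit.HubbardSuperconductivity.HubbardSuperconductivity.Theorems.KLProgrammeCooperResummation
open Summit.HubbardSuperconductivity.HubbardSuperconductivity.Theorems.KLProgrammeLegKernels
open Summit.HubbardSuperconductivity.HubbardSuperconductivity.Theorems.DispersionFlow
open Summit.HubbardSuperconductivity.HubbardSuperconductivity.Theorems.KLRegimeWick
open Summit.HubbardSuperconductivity.HubbardSuperconductivity.Theorems.EngineV8

section AnalyticResolvedSplit

variable (L M : ℕ) [NeZero L] [NeZero M]

set_option maxHeartbeats 3200000 in -- very long hypothesis bundle; plumbing into row 59 + continuity of the split integrands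
/-- **`pairTransferRelResIdx_family_succ_of_analytic_resolved_split`** — row 59 with the resolved source integral SPLIT into the member-difference integral `IΔ`, the two
loop-leg-resolved member integrals `J₁ J₂` convolved against the relative-weight profile `α`, per pair / class (module docstring). -/
theorem pairTransferRelResIdx_family_succ_of_analytic_resolved_split
    {R : RenConsts} {N : ℕ} {G : GeoConsts} (hCF : 0 ≤ G.CF) {P : SplitConsts} (hKl : 0 ≤ P.Klam) {r : ℝ} (hr : 0 ≤ r)
    {β U μ : ℝ} {n : ℕ} {mA θ : ℝ} (hm : 0 ≤ mA) (hθ0 : 0 ≤ θ)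
    (hKf : FrameOK R U N μ (klFlowFrameU L M β U μ (n + 1))) (hβ : klBetaMin ≤ β) (hβL : β ≤ L) (hη₀ : Real.pi / (L : ℝ) ≤ klScale klE0 n)
    (hnum : mA * ((2 : ℝ) ^ 10 * 15367) ≤ 1 / 3)
    (hZ : ∀ Λ ∈ Icc (klScale klE0 (n + 1)) (klScale klE0 n), hubbardEffPartitionFnCT L M β U μ 0 (klFlowFrameU L M β U μ (n + 1)) Λ ≠ 0)
    (A A' : ℕ → TorusSite 2 L → ℝ → Matrix (TorusSite 2 L) (TorusSite 2 L) ℂ) (b b' : ℕ → TorusSite 2 L → ℝ → TorusSite 2 L → ℂ)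
    (a : ℕ → ℕ → TorusSite 2 L → ℝ → TorusSite 2 L → ℂ)
    (hAdef : A = fun j Qm t => Matrix.of fun k k' : TorusSite 2 L => if k ∈ klBall L μ 0 ∧ k' ∈ klBall L μ 0 then
      vertexFn L M β (gaussConv ℂ
        (softCovOf L M β μ (klFlowFrameU L M β U μ (n + 1)) (softSymbolCompl L M β μ (klFlowFrameU L M β U μ (n + 1)) (n + 1) j) + hubbardCovAboveCT L M β μ 0 (klFlowFrameU L M β U μ (n + 1)) (klScale klE0 (n + 1)) -
          hubbardCovAboveCT L M β μ 0 (klFlowFrameU L M β U μ (n + 1)) (klScale klE0 n + t * (klScale klE0 (n + 1) - klScale klE0 n)))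
        (hubbardEffectiveActionCT L M β U μ 0 (klFlowFrameU L M β U μ (n + 1)) (klScale klE0 n + t * (klScale klE0 (n + 1) - klScale klE0 n)))) 4
        ![(((omega0 M, k'), 0), 0), ((((omega0 M).rev, Qm - k'), 1), 0), ((((omega0 M).rev, Qm - k), 1), 1), (((omega0 M, k), 0), 1)]
      else 0)
    (hA'def : A' = fun j Qm t => Matrix.of fun k k' : TorusSite 2 L => if k ∈ klBall L μ 0 ∧ k' ∈ klBall L μ 0 then
      (klScale klE0 (n + 1) - klScale klE0 n) • -((2 : ℂ)⁻¹ * vertexFn L M β (gaussConv ℂ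
        (softCovOf L M β μ (klFlowFrameU L M β U μ (n + 1)) (softSymbolCompl L M β μ (klFlowFrameU L M β U μ (n + 1)) (n + 1) j) + hubbardCovAboveCT L M β μ 0 (klFlowFrameU L M β U μ (n + 1)) (klScale klE0 (n + 1)) -
          hubbardCovAboveCT L M β μ 0 (klFlowFrameU L M β U μ (n + 1)) (klScale klE0 n + t * (klScale klE0 (n + 1) - klScale klE0 n)))
        (grassmannDerivPairing ℂ
          (Matrix.of fun X Y : HubbardFieldIdx L M => deriv (fun Λ'' : ℝ => hubbardCovAboveCT L M β μ 0 (klFlowFrameU L M β U μ (n + 1)) Λ'' X Y)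
            (klScale klE0 n + t * (klScale klE0 (n + 1) - klScale klE0 n)))
          (hubbardEffectiveActionCT L M β U μ 0 (klFlowFrameU L M β U μ (n + 1)) (klScale klE0 n + t * (klScale klE0 (n + 1) - klScale klE0 n)))
          (hubbardEffectiveActionCT L M β U μ 0 (klFlowFrameU L M β U μ (n + 1)) (klScale klE0 n + t * (klScale klE0 (n + 1) - klScale klE0 n))))) 4
        ![(((omega0 M, k'), 0), 0), ((((omega0 M).rev, Qm - k'), 1), 0), ((((omega0 M).rev, Qm - k), 1), 1), (((omega0 M, k), 0), 1)])
      else 0)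
    (hbdef : b = fun j Qm t p => -((klBubbleMass L M β μ (klFlowFrameU L M β U μ (n + 1))
        (fun k => (softSymbolCompl L M β μ (klFlowFrameU L M β U μ (n + 1)) (n + 1) j) k + (hubbardCutoffWeightCT L M β μ (klFlowFrameU L M β U μ (n + 1)) (klScale klE0 (n + 1)) k -
          hubbardCutoffWeightCT L M β μ (klFlowFrameU L M β U μ (n + 1)) (klScale klE0 n + t * (klScale klE0 (n + 1) - klScale klE0 n)) k))
        (fun k => (softSymbolCompl L M β μ (klFlowFrameU L M β U μ (n + 1)) (n + 1) j) k + (hubbardCutoffWeightCT L M β μ (klFlowFrameU L M β U μ (n + 1)) (klScale klE0 (n + 1)) k -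
          hubbardCutoffWeightCT L M β μ (klFlowFrameU L M β U μ (n + 1)) (klScale klE0 n + t * (klScale klE0 (n + 1) - klScale klE0 n)) k)) Qm p : ℝ) : ℂ))
    (hb'def : b' = fun j Qm t p => (((klScale klE0 (n + 1) - klScale klE0 n) *
        (klBubbleMass L M β μ (klFlowFrameU L M β U μ (n + 1))
            (fun k => deriv (fun Λ' => hubbardCutoffWeightCT L M β μ (klFlowFrameU L M β U μ (n + 1)) Λ' k) (klScale klE0 n + t * (klScale klE0 (n + 1) - klScale klE0 n)))
            (fun k => (softSymbolCompl L M β μ (klFlowFrameU L M β U μ (n + 1)) (n + 1) j) k + (hubbardCutoffWeightCT L M β μ (klFlowFrameU L M β U μ (n + 1)) (klScale klE0 (n + 1)) k -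
          hubbardCutoffWeightCT L M β μ (klFlowFrameU L M β U μ (n + 1)) (klScale klE0 n + t * (klScale klE0 (n + 1) - klScale klE0 n)) k)) Qm p +
          klBubbleMass L M β μ (klFlowFrameU L M β U μ (n + 1))
            (fun k => (softSymbolCompl L M β μ (klFlowFrameU L M β U μ (n + 1)) (n + 1) j) k + (hubbardCutoffWeightCT L M β μ (klFlowFrameU L M β U μ (n + 1)) (klScale klE0 (n + 1)) k -
          hubbardCutoffWeightCT L M β μ (klFlowFrameU L M β U μ (n + 1)) (klScale klE0 n + t * (klScale klE0 (n + 1) - klScale klE0 n)) k))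
            (fun k => deriv (fun Λ' => hubbardCutoffWeightCT L M β μ (klFlowFrameU L M β U μ (n + 1)) Λ' k) (klScale klE0 n + t * (klScale klE0 (n + 1) - klScale klE0 n)))
            Qm p) : ℝ) : ℂ))
    (hadef : a = fun j j' Qm t p => (b j Qm t p - b j' Qm t p) +
      (-(((klTransferWeight L M β μ (klFlowFrameU L M β U μ (n + 1)) (n + 1) (softSymbolCompl L M β μ (klFlowFrameU L M β U μ (n + 1)) (n + 1) j) Qm p -
          klTransferWeight L M β μ (klFlowFrameU L M β U μ (n + 1)) (n + 1) (softSymbolCompl L M β μ (klFlowFrameU L M β U μ (n + 1)) (n + 1) j') Qm p : ℝ)) : ℂ) -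
        (b j Qm 1 p - b j' Qm 1 p)))
    (ρ : ℕ → TorusSite 2 L → TorusSite 2 L → ℝ)
    (hρdef : ρ = fun j Qm c => klRungProfile L M β μ (klFlowFrameU L M β U μ (n + 1)) n (softSymbolCompl L M β μ (klFlowFrameU L M β U μ (n + 1)) (n + 1) j) Qm c)
    (ah : ℕ → ℕ → TorusSite 2 L → TorusSite 2 L → ℂ)
    (hahdef : ah = fun j j' Qm c => -(((klTransferWeight L M β μ (klFlowFrameU L M β U μ n) n (softSymbolCompl L M β μ (klFlowFrameU L M β U μ n) n j) Qm c -
            klTransferWeight L M β μ (klFlowFrameU L M β U μ n) n (softSymbolCompl L M β μ (klFlowFrameU L M β U μ n) n j') Qm c : ℝ)) : ℂ))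
    (hhist : ∀ j j' : ℕ, n ≤ j' → j' ≤ j → j ≤ nScales β + 1 → ∀ Qm : TorusSite 2 L, IsPairClassAt L Qm n →
      ∀ k ∈ klBall L μ 0, ∀ k' ∈ klBall L μ 0,
      ‖(klMemberArrayF L M β U μ n (softSymbolCompl L M β μ (klFlowFrameU L M β U μ n) n j) Qm + klMemberArrayF L M β U μ n (softSymbolCompl L M β μ (klFlowFrameU L M β U μ n) n j) Qm *
          diagonal (fun c => -(((klTransferWeight L M β μ (klFlowFrameU L M β U μ n) n (softSymbolCompl L M β μ (klFlowFrameU L M β U μ n) n j) Qm c -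
            klTransferWeight L M β μ (klFlowFrameU L M β U μ n) n (softSymbolCompl L M β μ (klFlowFrameU L M β U μ n) n j') Qm c : ℝ)) : ℂ)) * klMemberArrayF L M β U μ n (softSymbolCompl L M β μ (klFlowFrameU L M β U μ n) n j') Qm -
          klMemberArrayF L M β U μ n (softSymbolCompl L M β μ (klFlowFrameU L M β U μ n) n j') Qm) k k'‖ ≤ θ * transferBarRelIdx L G P r β U n j' Qm k k')
    (hdata : ∀ j j' : ℕ, n + 1 ≤ j' → j' ≤ j → j ≤ nScales β + 1 → ∀ Qm : TorusSite 2 L, IsPairClassAt L Qm (n + 1) →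
      ∃ (ηr η₁ η₂ R₀ IΔ J₁ J₂ Ran : TorusSite 2 L → TorusSite 2 L → ℝ) (d α : TorusSite 2 L → ℝ),
        -- ANALYTIC: a priori size of the two member arrays along the slice
        (∀ t ∈ Icc (0 : ℝ) 1, ∀ x y, ‖A j Qm t x y‖ ≤ mA) ∧ (∀ t ∈ Icc (0 : ℝ) 1, ∀ x y, ‖A j' Qm t x y‖ ≤ mA) ∧
        -- the history array's a priori size; the START RE-FRAME majorants ((F)(i) lane) against the history objects at frame `K_n`
        (∀ x y, ‖klMemberArrayF L M β U μ n (softSymbolCompl L M β μ (klFlowFrameU L M β U μ n) n j) Qm x y‖ ≤ mA) ∧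
        (∀ x y, ‖((A j Qm 0 - klMemberArrayF L M β U μ n (softSymbolCompl L M β μ (klFlowFrameU L M β U μ n) n j) Qm) - (A j' Qm 0 - klMemberArrayF L M β U μ n (softSymbolCompl L M β μ (klFlowFrameU L M β U μ n) n j') Qm)) x y‖ ≤ ηr x y) ∧
        (∀ x y, ‖(A j Qm 0 - klMemberArrayF L M β U μ n (softSymbolCompl L M β μ (klFlowFrameU L M β U μ n) n j) Qm) x y‖ ≤ η₁ x y) ∧
        (∀ x y, ‖(A j' Qm 0 - klMemberArrayF L M β U μ n (softSymbolCompl L M β μ (klFlowFrameU L M β U μ n) n j') Qm) x y‖ ≤ η₂ x y) ∧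
        (∀ c, ‖a j j' Qm 0 c - ah j j' Qm c‖ ≤ d c) ∧
        (∀ x y, (ηr x y + mA * ∑ c, η₁ x c * (d c + ‖ah j j' Qm c‖) + mA * mA * ∑ c, d c + mA * ∑ c, ‖ah j j' Qm c‖ * η₂ c y) ≤ R₀ x y) ∧
        -- ANALYTIC, RESOLVED and SPLIT (k3c1-p1 g15 row 60): the slice integral of the DIFFERENCE of the two members' Riccati defects (every term carries the `D`-line),
        -- the slice integrals of each member's Riccati defect RESOLVED IN THE LOOP LEG, and a `t`-uniform profile `α` of the running relative weight —
        -- the member defects enter ONLY through `Σ_c J₁(x,c)·α(c)` and `Σ_c α(c)·J₂(c,y)` (angular-mass rows), never as sups (`kltc_relSource_resolved_le`)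
        (∀ x y, (∫ t in (0 : ℝ)..1, ‖((A' j Qm t + A j Qm t * diagonal (b' j Qm t) * A j Qm t) - (A' j' Qm t + A j' Qm t * diagonal (b' j' Qm t) * A j' Qm t)) x y‖) ≤ IΔ x y) ∧
        (∀ x c, (∫ t in (0 : ℝ)..1, ‖(A' j Qm t + A j Qm t * diagonal (b' j Qm t) * A j Qm t) x c‖) ≤ J₁ x c) ∧
        (∀ c y, (∫ t in (0 : ℝ)..1, ‖(A' j' Qm t + A j' Qm t * diagonal (b' j' Qm t) * A j' Qm t) c y‖) ≤ J₂ c y) ∧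
        (∀ t ∈ Icc (0 : ℝ) 1, ∀ c, ‖a j j' Qm t c‖ ≤ α c) ∧
        -- the ANALYTIC majorant `Ran` = re-frame part + the split source
        (∀ x y, R₀ x y + (IΔ x y + mA * ∑ c, J₁ x c * α c + mA * ∑ c, α c * J₂ c y) ≤ Ran x y) ∧
        -- ITS budget: the four-term FT form of `Ran` against the frame slack of the inherited bar plus three fifths of the slice's ROOM
        (∀ k ∈ klBall L μ 0, ∀ k' ∈ klBall L μ 0,
          Ran k k' + ∑ c, Ran k c * ρ j' Qm c * (3 / 2 * mA) + ∑ a', 3 / 2 * mA * ρ j Qm a' * Ran a' k' +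
              ∑ a', ∑ c, 3 / 2 * mA * ρ j Qm a' * Ran a' c * ρ j' Qm c * (3 / 2 * mA) ≤
            θ * (((2 : ℝ) ^ (n + 2))⁻¹ * transferBarRelIdx L G P r β U n j' Qm k k' + 3 / 5 *
              (klIdxPrefactor r (n + 1) * ((P.Klam * U) ^ 2 *
              ((min (klTorusNorm L (k - k') / klScale klE0 (n + 1)) (klScale klE0 (n + 1) / klTorusNorm L (k - k')) +
                  min (klTorusNorm L (k + k' - Qm) / klScale klE0 (n + 1)) (klScale klE0 (n + 1) / klTorusNorm L (k + k' - Qm)) +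
                  ((2 : ℝ) ^ n)⁻¹ + 3 * ((L : ℝ))⁻¹) * klIdxMass n j' + ((4 : ℝ) ^ (n + 1))⁻¹ * klIdxOverlap (n + 1) j') +
            ((P.Klam * |U|) ^ 3 * ((2 : ℝ) ^ n)⁻¹ + 3 * thermalBar G P U β (n + 1)) * klIdxMass n j'))))) :
    ∀ j j' : ℕ, n + 1 ≤ j' → j' ≤ j → j ≤ nScales β + 1 → ∀ Qm : TorusSite 2 L, IsPairClassAt L Qm (n + 1) →
      ∀ k ∈ klBall L μ 0, ∀ k' ∈ klBall L μ 0,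
      ‖(klMemberArrayF L M β U μ (n + 1) (softSymbolCompl L M β μ (klFlowFrameU L M β U μ (n + 1)) (n + 1) j) Qm + klMemberArrayF L M β U μ (n + 1) (softSymbolCompl L M β μ (klFlowFrameU L M β U μ (n + 1)) (n + 1) j) Qm *
          diagonal (fun p => -(((klTransferWeight L M β μ (klFlowFrameU L M β U μ (n + 1)) (n + 1) (softSymbolCompl L M β μ (klFlowFrameU L M β U μ (n + 1)) (n + 1) j) Qm p -
            klTransferWeight L M β μ (klFlowFrameU L M β U μ (n + 1)) (n + 1) (softSymbolCompl L M β μ (klFlowFrameU L M β U μ (n + 1)) (n + 1) j') Qm p : ℝ)) : ℂ)) * klMemberArrayF L M β U μ (n + 1) (softSymbolCompl L M β μ (klFlowFrameU L M β U μ (n + 1)) (n + 1) j') Qm -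
          klMemberArrayF L M β U μ (n + 1) (softSymbolCompl L M β μ (klFlowFrameU L M β U μ (n + 1)) (n + 1) j') Qm) k k'‖ ≤ θ * transferBarRelIdx L G P r β U (n + 1) j' Qm k k' := by
  subst hahdef
  refine pairTransferRelResIdx_family_succ_of_analytic_resolved L M hCF hKl hr hm hθ0 hKf hβ hβL hη₀ hnum hZ A A' b b' a hAdef hA'def hbdef hb'def hadef
    ρ hρdef _ rfl hhist ?_
  intro j j' h1 h2 h3 Qm hQm
  obtain ⟨ηr, η₁, η₂, R₀, IΔ, J₁, J₂, Ran, d, α, hA₁, hA₂, hH, hηr, hη₁, hη₂, hd, hR₀, hΔ, hJ₁, hJ₂, hα, hRan, hbud⟩ := hdata j j' h1 h2 h3 Qm hQm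
  -- the members' flow data (for the continuity of the integrands)
  obtain ⟨hdA₁, hcA₁, -, -⟩ := klmf_memberArray_flowData L M β U μ (klFlowFrameU L M β U μ (n + 1)) n
    (softSymbolCompl L M β μ (klFlowFrameU L M β U μ (n + 1)) (n + 1) j) Qm hZ (A j Qm) (A' j Qm) (by rw [hAdef]) (by rw [hA'def])
  obtain ⟨hdA₂, hcA₂, -, -⟩ := klmf_memberArray_flowData L M β U μ (klFlowFrameU L M β U μ (n + 1)) n
    (softSymbolCompl L M β μ (klFlowFrameU L M β U μ (n + 1)) (n + 1) j') Qm hZ (A j' Qm) (A' j' Qm) (by rw [hAdef]) (by rw [hA'def])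
  obtain ⟨hdb₁, hcb₁, hb₁e⟩ := klmf_rung_data L M β μ (klFlowFrameU L M β U μ (n + 1)) n
    (softSymbolCompl L M β μ (klFlowFrameU L M β U μ (n + 1)) (n + 1) j) Qm (b j Qm) (b' j Qm) (by rw [hbdef]) (by rw [hb'def])
  obtain ⟨hdb₂, hcb₂, hb₂e⟩ := klmf_rung_data L M β μ (klFlowFrameU L M β U μ (n + 1)) n
    (softSymbolCompl L M β μ (klFlowFrameU L M β U μ (n + 1)) (n + 1) j') Qm (b j' Qm) (b' j' Qm) (by rw [hbdef]) (by rw [hb'def])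
  obtain ⟨hda, -, -⟩ := klmf_relWeight_data L M β μ (klFlowFrameU L M β U μ (n + 1)) n
    (softSymbolCompl L M β μ (klFlowFrameU L M β U μ (n + 1)) (n + 1) j) (softSymbolCompl L M β μ (klFlowFrameU L M β U μ (n + 1)) (n + 1) j')
    Qm (b j Qm) (b j' Qm) (b' j Qm) (b' j' Qm) (a j j' Qm) hdb₁ hdb₂ hb₁e hb₂e (by rw [hadef])
  obtain ⟨-, hS₁c⟩ := klmf_riccati_of_defect (A j Qm) (A' j Qm) _ (b' j Qm) hdA₁ hcA₁ hcb₁ rfl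
  obtain ⟨-, hS₂c⟩ := klmf_riccati_of_defect (A j' Qm) (A' j' Qm) _ (b' j' Qm) hdA₂ hcA₂ hcb₂ rfl
  have hA₁c : ∀ u v, ContinuousOn (fun t => A j Qm t u v) (Icc 0 1) := fun u v t ht => (hdA₁ t ht u v).continuousAt.continuousWithinAt
  have hA₂c : ∀ u v, ContinuousOn (fun t => A j' Qm t u v) (Icc 0 1) := fun u v t ht => (hdA₂ t ht u v).continuousAt.continuousWithinAt
  have hac : ∀ c, ContinuousOn (fun t => a j j' Qm t c) (Icc 0 1) := fun c t ht => (hda t ht c).continuousAt.continuousWithinAt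
  have hDa : ∀ u v, ContinuousOn (fun t => diagonal (a j j' Qm t) u v) (Icc 0 1) := kltc_continuousOn_diagonal_apply hac
  have hone : ∀ u v, ContinuousOn (fun _ : ℝ => (1 : Matrix (TorusSite 2 L) (TorusSite 2 L) ℂ) u v) (Icc 0 1) := fun u v => continuousOn_const
  have hα0 : ∀ c, 0 ≤ α c := fun c => (norm_nonneg _).trans (hα 0 ⟨le_rfl, zero_le_one⟩ c)
  refine ⟨ηr, η₁, η₂, R₀, fun x y => IΔ x y + mA * ∑ c, J₁ x c * α c + mA * ∑ c, α c * J₂ c y, Ran, d,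
    hA₁, hA₂, hH, hηr, hη₁, hη₂, hd, hR₀, ?_, hRan, hbud⟩
  -- the resolved source integral from the split rows
  intro x y
  -- names for the two Riccati defects and the relative source
  set S₁ : ℝ → Matrix (TorusSite 2 L) (TorusSite 2 L) ℂ := fun t => A' j Qm t + A j Qm t * diagonal (b' j Qm t) * A j Qm t with hS₁
  set S₂ : ℝ → Matrix (TorusSite 2 L) (TorusSite 2 L) ℂ := fun t => A' j' Qm t + A j' Qm t * diagonal (b' j' Qm t) * A j' Qm t with hS₂
  set g : ℝ → ℝ := fun t => ‖(S₁ t - S₂ t) x y‖ + mA * ∑ c, ‖S₁ t x c‖ * α c + mA * ∑ c, α c * ‖S₂ t c y‖ with hg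
  -- pointwise bound
  have hpt : ∀ t ∈ Icc (0 : ℝ) 1, ‖(S₁ t * (1 + diagonal (a j j' Qm t) * A j' Qm t) + A j Qm t * diagonal (a j j' Qm t) * S₂ t - S₂ t) x y‖ ≤ g t := by
    intro t ht
    have h := kltc_relSource_resolved_le (S₁ t) (S₂ t) (A j Qm t) (A j' Qm t) (a j j' Qm t) (hA₁ t ht) (hA₂ t ht) x y
    refine h.trans ?_
    simp only [hg]
    have h1 : ∑ c, ‖S₁ t x c‖ * ‖a j j' Qm t c‖ ≤ ∑ c, ‖S₁ t x c‖ * α c :=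
      sum_le_sum fun c _ => mul_le_mul_of_nonneg_left (hα t ht c) (norm_nonneg _)
    have h2 : ∑ c, ‖a j j' Qm t c‖ * ‖S₂ t c y‖ ≤ ∑ c, α c * ‖S₂ t c y‖ :=
      sum_le_sum fun c _ => mul_le_mul_of_nonneg_right (hα t ht c) (norm_nonneg _)
    have := mul_le_mul_of_nonneg_left h1 hm
    have := mul_le_mul_of_nonneg_left h2 hm
    linarith
  -- continuity of both sides on `[0,1]`
  have hXc : ContinuousOn (fun t => ‖(S₁ t * (1 + diagonal (a j j' Qm t) * A j' Qm t) + A j Qm t * diagonal (a j j' Qm t) * S₂ t - S₂ t) x y‖) (Icc 0 1) := by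
    have h : ∀ u v, ContinuousOn (fun t => (S₁ t * (1 + diagonal (a j j' Qm t) * A j' Qm t) + A j Qm t * diagonal (a j j' Qm t) * S₂ t - S₂ t) u v) (Icc 0 1) :=
      kltc_continuousOn_sub_apply
        (kltc_continuousOn_add_apply
          (kltc_continuousOn_mul_apply hS₁c (kltc_continuousOn_add_apply hone (kltc_continuousOn_mul_apply hDa hA₂c)))
          (kltc_continuousOn_mul_apply (kltc_continuousOn_mul_apply hA₁c hDa) hS₂c))
        hS₂c
    exact (h x y).norm
  have hd_c : ContinuousOn (fun t => ‖(S₁ t - S₂ t) x y‖) (Icc 0 1) := (kltc_continuousOn_sub_apply hS₁c hS₂c x y).norm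
  have h1_c : ∀ c, ContinuousOn (fun t => ‖S₁ t x c‖ * α c) (Icc 0 1) := fun c => (hS₁c x c).norm.mul continuousOn_const
  have h2_c : ∀ c, ContinuousOn (fun t => α c * ‖S₂ t c y‖) (Icc 0 1) := fun c => continuousOn_const.mul (hS₂c c y).norm
  have hsum1_c : ContinuousOn (fun t => mA * ∑ c, ‖S₁ t x c‖ * α c) (Icc 0 1) := continuousOn_const.mul (continuousOn_finsetSum _ fun c _ => h1_c c)
  have hsum2_c : ContinuousOn (fun t => mA * ∑ c, α c * ‖S₂ t c y‖) (Icc 0 1) := continuousOn_const.mul (continuousOn_finsetSum _ fun c _ => h2_c c)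
  have hgc : ContinuousOn g (Icc 0 1) := by
    simp only [hg]; exact (hd_c.add hsum1_c).add hsum2_c
  have hI01 : Set.uIcc (0 : ℝ) 1 = Set.Icc (0 : ℝ) 1 := Set.uIcc_of_le zero_le_one
  have hii : ∀ {f : ℝ → ℝ}, ContinuousOn f (Icc (0 : ℝ) 1) → IntervalIntegrable f MeasureTheory.volume 0 1 := fun hf =>
    (hf.mono hI01.subset).intervalIntegrable
  -- integrate
  have hmono := intervalIntegral.integral_mono_on zero_le_one (hii hXc) (hii hgc) hpt
  refine hmono.trans ?_
  have hsplit : (∫ t in (0 : ℝ)..1, g t) = (∫ t in (0 : ℝ)..1, ‖(S₁ t - S₂ t) x y‖) +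
      mA * ∑ c, (∫ t in (0 : ℝ)..1, ‖S₁ t x c‖) * α c + mA * ∑ c, α c * ∫ t in (0 : ℝ)..1, ‖S₂ t c y‖ := by
    simp only [hg]
    rw [intervalIntegral.integral_add ((hii hd_c).add (hii hsum1_c)) (hii hsum2_c), intervalIntegral.integral_add (hii hd_c) (hii hsum1_c),
      intervalIntegral.integral_const_mul, intervalIntegral.integral_const_mul,
      intervalIntegral.integral_finsetSum (fun c _ => hii (h1_c c)), intervalIntegral.integral_finsetSum (fun c _ => hii (h2_c c))]
    simp_rw [intervalIntegral.integral_mul_const, intervalIntegral.integral_const_mul]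
  rw [hsplit]
  have t1 := hΔ x y
  have t2 : ∑ c, (∫ t in (0 : ℝ)..1, ‖S₁ t x c‖) * α c ≤ ∑ c, J₁ x c * α c :=
    sum_le_sum fun c _ => mul_le_mul_of_nonneg_right (hJ₁ x c) (hα0 c)
  have t3 : ∑ c, α c * (∫ t in (0 : ℝ)..1, ‖S₂ t c y‖) ≤ ∑ c, α c * J₂ c y :=
    sum_le_sum fun c _ => mul_le_mul_of_nonneg_left (hJ₂ c y) (hα0 c)
  have := mul_le_mul_of_nonneg_left t2 hm
  have := mul_le_mul_of_nonneg_left t3 hm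
  simp only [hS₁, hS₂] at t1 ⊢
  linarith

end AnalyticResolvedSplit

end Summit.HubbardSuperconductivity.HubbardSuperconductivity.Theorems.KLRegimeSplit

end
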